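import Literature.AlgebraicGeometry.Resolution.ExtAnnihilatorBaseChange
import Literature.AlgebraicGeometry.Resolution.ExtAnnihilatorLocalizationWindow
import Literature.AlgebraicGeometry.Resolution.SecantColonAnnihilatorCMClause
import Literature.AlgebraicGeometry.Resolution.ColonSecantFiniteType
import Literature.RingTheory.KrullDimension.AffineCatenary
import Mathlib.RingTheory.Localization.BaseChange
import Mathlib.Algebra.Module.LocalizedModule.IsLocalization
import Mathlib.RingTheory.KrullDimension.Field
import HarnessLib

/-!
# A global `Ext`-annihilator ideal on an affine variety: nonzero, and Cohen–Macaulay off its zeros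

Topic: `Literature/AlgebraicGeometry/Resolution` (affine globalization of Theorem A, the
dualizing-complex-free replacement of [Kawasaki2000, La. 2.4] / [Cesnavicius2021, (AR-b)] for
integral affine schemes of finite type over a field).

Let `k` be a field, `B` a regular affine `k`-domain of dimension `n` (e.g. `B = k[x₁,…,xₙ]`,
`ringKrullDim_mvPolynomial_fin_eq`), `I ⊆ B` a prime ideal, `A = B/I` of dimension `d`, and `F`
a free resolution of finite type of the `B`-module `A`. The **global `Ext`-annihilator ideal** is
`𝔠 = ∏_{q ∈ (n-d, max n 2]} Ann_B E^q(F) ⊆ B` and `J = 𝔠A ⊆ A`.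

* `underPrime`, `quotientLocalizationAlgebra`, `toLocalizationLinearMap`,
  `isBaseChange_toLocalizationLinearMap`, `FreeResolution.quotientLocalize` — for a prime `𝔓` of
  `A` and `𝔭 = 𝔓 ∩ B`: the surjection `B_𝔭 ↠ A_𝔓`, and `A → A_𝔓` as a base change of the
  `B`-module `A` to `B_𝔭`, so that `F ⊗_B B_𝔭` resolves `A_𝔓` over the regular local ring `B_𝔭`.
* `height_add_eq_of_ringKrullDim_quotient` — `ht 𝔭 + dim B/𝔭 = n` (affine domain).
* `prod_annihilator_EMod_not_le_of_quotient`, `map_prod_annihilator_EMod_ne_bot` — `𝔠 ⊄ I`,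
  i.e. **`J ≠ 0`** (`(A1)` over the regular domain `B` at the prime `I` of height `n - d`).
* `exists_window` — the local index window `(ht 𝔭 - dim A_𝔓, max (ht 𝔭) 2]` lies in the global
  one `(n - d, max n 2]` (`dim A_𝔓 + dim B/𝔭 ≤ d`, `SupportDimLocalization.lean`).
* `cmClause_localization_of_not_le` — **off `V(J)` the local rings of `Spec A` are
  Cohen–Macaulay**: for a prime `𝔓 ⊉ J` every system of parameters of `A_𝔓` is a weakly regular
  sequence (the literal Cohen–Macaulay clause of `KawasakiMacaulayfication`), by
  `𝔠 B_𝔭 = B_𝔭 ⟹ 𝔠(F ⊗ B_𝔭) = B_𝔭` and `cmClause_of_prod_annihilator_EMod_eq_top`.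

These are the bullets "`J ≠ ⊥`" and "points off `supp J` are Cohen–Macaulay" of the endgame shape
`kawasakiMacaulayfication_of_exists_isBlowup_nonCMLocus` (`CohenMacaulayClosedPoints.lean`) in the
affine case. [cite: Kawasaki2000, La. 2.4, Thm. 5.1 (proof); Cesnavicius2021, §2 (AR-b)]
-/

noncomputable section

open IsLocalRing Ideal Module

universe u

namespace Literature.AlgebraicGeometry.Resolution

/-! ## Arithmetic of index windows -/

/-- Index windows, pure arithmetic: `n' + e = n` and `d' + e ≤ d` give
`(n'-d', max n' 2] ⊆ (n-d, max n 2]`. [folklore] -/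
theorem Ioc_subset_Ioc_of_add_eq_of_add_le {n d n' d' e : ℕ} (hsum : n' + e = n)
    (hle : d' + e ≤ d) : Finset.Ioc (n' - d') (max n' 2) ⊆ Finset.Ioc (n - d) (max n 2) := by
  intro q hq
  rw [Finset.mem_Ioc] at hq ⊢
  omega

/-- Members of `(a, b]` are positive. [folklore] -/
theorem one_le_of_mem_Ioc {a b q : ℕ} (hq : q ∈ Finset.Ioc a b) : 1 ≤ q :=
  Nat.lt_of_le_of_lt (Nat.zero_le a) (Finset.mem_Ioc.mp hq).1

/-- `dim k[x₁,…,xₙ] = n`. [folklore] -/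
theorem ringKrullDim_mvPolynomial_fin_eq (k : Type u) [Field k] (n : ℕ) :
    ringKrullDim (MvPolynomial (Fin n) k) = n := by
  rw [MvPolynomial.ringKrullDim_of_isNoetherianRing, ringKrullDim_eq_zero_of_field]
  simp

/-! ## The local rings `A_𝔓` as base changes of `A` to `B_𝔭`, `𝔭 = 𝔓 ∩ B` -/

section LocalRings

variable {B : Type u} [CommRing B] (I : Ideal B) (𝔓 : Ideal (B ⧸ I)) [𝔓.IsPrime]

/-- `𝔭 = 𝔓 ∩ B`, the prime of `B` under the prime `𝔓` of `A = B/I`. [folklore] -/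
abbrev underPrime : Ideal B := 𝔓.comap (Ideal.Quotient.mk I)

/-- The canonical surjection `B_𝔭 ↠ A_𝔓` (`𝔭 = 𝔓 ∩ B`), as an algebra structure. [folklore] -/
@[reducible] def quotientLocalizationAlgebra :
    Algebra (Localization.AtPrime (underPrime I 𝔓)) (Localization.AtPrime 𝔓) :=
  (Localization.localRingHom (underPrime I 𝔓) 𝔓 (Ideal.Quotient.mk I) rfl).toAlgebra

attribute [local instance] quotientLocalizationAlgebra

/-- `B_𝔭 → A_𝔓` is surjective. [folklore] -/
theorem algebraMap_quotientLocalization_surjective :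
    Function.Surjective
      (algebraMap (Localization.AtPrime (underPrime I 𝔓)) (Localization.AtPrime 𝔓)) :=
  Localization.localRingHom_surjective (Ideal.Quotient.mk I) Ideal.Quotient.mk_surjective 𝔓

/-- `B → B_𝔭 → A_𝔓` is `B → A → A_𝔓`. [folklore] -/
theorem isScalarTower_quotientLocalization :
    IsScalarTower B (Localization.AtPrime (underPrime I 𝔓)) (Localization.AtPrime 𝔓) :=
  IsScalarTower.of_algebraMap_eq fun x => by
    show algebraMap _ _ x =
      Localization.localRingHom (underPrime I 𝔓) 𝔓 (Ideal.Quotient.mk I) rfl (algebraMap _ _ x)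
    rw [Localization.localRingHom_to_map, IsScalarTower.algebraMap_apply B (B ⧸ I)]
    rfl

attribute [local instance] isScalarTower_quotientLocalization

/-- The `B`-linear map `A → A_𝔓`. [folklore] -/
def toLocalizationLinearMap : (B ⧸ I) →ₗ[B] Localization.AtPrime 𝔓 :=
  (IsScalarTower.toAlgHom B (B ⧸ I) (Localization.AtPrime 𝔓)).toLinearMap

/-- `toLocalizationLinearMap` is the algebra map. [folklore] -/
@[simp] theorem toLocalizationLinearMap_apply (a : B ⧸ I) :
    toLocalizationLinearMap I 𝔓 a = algebraMap (B ⧸ I) (Localization.AtPrime 𝔓) a := rfl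

/-- The image of `B ∖ 𝔭` in `A` is `A ∖ 𝔓`. [folklore] -/
theorem algebraMapSubmonoid_primeCompl_underPrime :
    Algebra.algebraMapSubmonoid (B ⧸ I) (underPrime I 𝔓).primeCompl = 𝔓.primeCompl := by
  ext a
  simp only [Algebra.algebraMapSubmonoid, Submonoid.mem_map, Ideal.mem_primeCompl_iff]
  constructor
  · rintro ⟨b, hb, rfl⟩
    exact fun h => hb (by rw [Ideal.mem_comap]; exact h)
  · intro ha
    obtain ⟨b, rfl⟩ := Ideal.Quotient.mk_surjective a
    exact ⟨b, fun hb => ha (by rw [Ideal.mem_comap] at hb; exact hb), rfl⟩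

/-- `A → A_𝔓` is a localization of the `B`-module `A` at `𝔭`. [folklore] -/
theorem isLocalizedModule_toLocalizationLinearMap :
    IsLocalizedModule (underPrime I 𝔓).primeCompl (toLocalizationLinearMap I 𝔓) := by
  rw [toLocalizationLinearMap, isLocalizedModule_iff_isLocalization,
    algebraMapSubmonoid_primeCompl_underPrime]
  infer_instance

/-- `A → A_𝔓` is a base change of the `B`-module `A` to `B_𝔭`. [folklore] -/
theorem isBaseChange_toLocalizationLinearMap :
    IsBaseChange (Localization.AtPrime (underPrime I 𝔓)) (toLocalizationLinearMap I 𝔓) :=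
  haveI := isLocalizedModule_toLocalizationLinearMap I 𝔓
  IsLocalizedModule.isBaseChange (underPrime I 𝔓).primeCompl _ _

/-- `A_𝔓` is finite over `B_𝔭`. [folklore] -/
theorem finite_quotientLocalization :
    Module.Finite (Localization.AtPrime (underPrime I 𝔓)) (Localization.AtPrime 𝔓) :=
  Module.Finite.of_surjective (Algebra.linearMap _ _)
    (algebraMap_quotientLocalization_surjective I 𝔓)

attribute [local instance] finite_quotientLocalization

/-- `F ⊗_B B_𝔭`: the base change of a free resolution `F` of the `B`-module `A` along `A → A_𝔓`,
a free resolution of finite type of `A_𝔓` over `B_𝔭`.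
[cite: Matsumura1987, §19 (after Lemma 4)] -/
def FreeResolution.quotientLocalize (F : FreeResolution B (B ⧸ I)) :
    FreeResolution (Localization.AtPrime (underPrime I 𝔓)) (Localization.AtPrime 𝔓) :=
  F.baseChange (Localization.AtPrime (underPrime I 𝔓)) (toLocalizationLinearMap I 𝔓)
    (isBaseChange_toLocalizationLinearMap I 𝔓)

/-- `𝔠`-type products localize into the `Ext`-annihilator products of `F ⊗_B B_𝔭`
(`ExtAnnihilatorBaseChange.lean`, specialized). [folklore] -/
theorem map_prod_annihilator_EMod_le_quotientLocalize [IsNoetherianRing B]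
    (F : FreeResolution B (B ⧸ I)) (T : Finset ℕ) (hT : ∀ q ∈ T, 1 ≤ q) :
    (∏ q ∈ T, Module.annihilator B (F.EMod q)).map
        (algebraMap B (Localization.AtPrime (underPrime I 𝔓))) ≤
      ∏ q ∈ T, Module.annihilator (Localization.AtPrime (underPrime I 𝔓))
        ((F.quotientLocalize I 𝔓).EMod q) :=
  F.map_prod_annihilator_EMod_baseChange_le (underPrime I 𝔓) (toLocalizationLinearMap I 𝔓)
    (isBaseChange_toLocalizationLinearMap I 𝔓) T hT

/-- `dim A_𝔓 + dim B/𝔭 ≤ dim A` (as `B_𝔭`-module `A_𝔓 ≅ A ⊗_B B_𝔭`). [cite: Matsumura1987, §5] -/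
theorem supportDim_quotientLocalization_add_le :
    Module.supportDim (Localization.AtPrime (underPrime I 𝔓)) (Localization.AtPrime 𝔓) +
        ringKrullDim (B ⧸ underPrime I 𝔓) ≤ Module.supportDim B (B ⧸ I) := by
  have hAnn : Module.annihilator B (B ⧸ I) ≤ underPrime I 𝔓 := by
    rw [Ideal.annihilator_quotient]
    intro x hx
    rw [Ideal.mem_comap, Ideal.Quotient.eq_zero_iff_mem.mpr hx]
    exact 𝔓.zero_mem
  have hdimeq : Module.supportDim (Localization.AtPrime (underPrime I 𝔓))
      (LocalizedModule (underPrime I 𝔓).primeCompl (B ⧸ I)) =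
        Module.supportDim (Localization.AtPrime (underPrime I 𝔓)) (Localization.AtPrime 𝔓) :=
    Module.supportDim_eq_of_equiv
      ((FreeResolution.isBaseChange_mkLinearMap (M := B ⧸ I) (underPrime I 𝔓)).equiv.symm.trans
        (isBaseChange_toLocalizationLinearMap I 𝔓).equiv)
  exact hdimeq ▸ supportDim_localizedModule_add_ringKrullDim_quotient_le (underPrime I 𝔓) hAnn

end LocalRings

/-! ## Dimension counts over a regular affine domain -/

section Affine

variable (k : Type u) [Field k] {B : Type u} [CommRing B] [IsDomain B] [Algebra k B]
  [Algebra.FiniteType k B] {n : ℕ} (hB : ringKrullDim B = n)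

include k hB in
/-- **`ht 𝔭 + dim B/𝔭 = n`** for a prime `𝔭` of an affine domain `B` of dimension `n`, as natural
numbers. [cite: Matsumura1987, Thm. 5.6] -/
theorem height_add_eq_of_ringKrullDim_quotient (𝔭 : Ideal B) [𝔭.IsPrime] {e : ℕ}
    (he : ringKrullDim (B ⧸ 𝔭) = e) {h : ℕ} (hh : 𝔭.height = h) : h + e = n := by
  have key := Literature.RingTheory.KrullDimension.ringKrullDim_quotient_add_height k 𝔭
  rw [he, hh, hB] at key
  have : ((e + h : ℕ) : WithBot ℕ∞) = n := by rw [← key]; rfl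
  have := (show (e + h : ℕ) = n by exact_mod_cast this)
  omega

omit [IsDomain B] in
include k in
/-- The height of a prime of an affine ring is a natural number. [folklore] -/
theorem exists_height_eq (𝔭 : Ideal B) [𝔭.IsPrime] : ∃ h : ℕ, 𝔭.height = h := by
  haveI : IsNoetherianRing B := Algebra.FiniteType.isNoetherianRing k B
  obtain ⟨h, hh⟩ := ENat.ne_top_iff_exists.mp (Ideal.height_lt_top_of_isPrime (I := 𝔭)).ne
  exact ⟨h, hh.symm⟩

include k hB in
/-- **The local index window lies in the global one**: for a prime `𝔓` of `A = B/I`,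
`𝔭 = 𝔓 ∩ B`, `n' = ht 𝔭 = dim B_𝔭`, `d' = dim A_𝔓`, `d = dim A`:
`(n'-d', max n' 2] ⊆ (n-d, max n 2]`. [cite: Matsumura1987, §5, Thm. 5.6] -/
theorem exists_window (I : Ideal B) (𝔓 : Ideal (B ⧸ I)) [𝔓.IsPrime] {d : ℕ}
    (hd : ringKrullDim (B ⧸ I) = d) :
    letI := quotientLocalizationAlgebra I 𝔓
    ∃ n' d' : ℕ, ringKrullDim (Localization.AtPrime (underPrime I 𝔓)) = n' ∧
      Module.supportDim (Localization.AtPrime (underPrime I 𝔓)) (Localization.AtPrime 𝔓) = d' ∧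
        Finset.Ioc (n' - d') (max n' 2) ⊆ Finset.Ioc (n - d) (max n 2) := by
  letI := quotientLocalizationAlgebra I 𝔓
  haveI := finite_quotientLocalization I 𝔓
  haveI : IsNoetherianRing B := Algebra.FiniteType.isNoetherianRing k B
  obtain ⟨n', hn'⟩ := exists_height_eq k (underPrime I 𝔓)
  have hdimBp : ringKrullDim (Localization.AtPrime (underPrime I 𝔓)) = n' := by
    rw [IsLocalization.AtPrime.ringKrullDim_eq_height (underPrime I 𝔓)
      (Localization.AtPrime (underPrime I 𝔓)), hn']; rfl
  obtain ⟨d', hd'⟩ : ∃ d' : ℕ, Module.supportDim (Localization.AtPrime (underPrime I 𝔓))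
      (Localization.AtPrime 𝔓) = d' := by
    obtain ⟨a, ha⟩ := WithBot.ne_bot_iff_exists.mp (Module.supportDim_ne_bot_of_nontrivial
      (Localization.AtPrime (underPrime I 𝔓)) (Localization.AtPrime 𝔓))
    have ha' : a ≠ ⊤ := by
      rintro rfl
      exact supportDim_ne_top (R := Localization.AtPrime (underPrime I 𝔓))
        (M := Localization.AtPrime 𝔓) ha.symm
    obtain ⟨d', rfl⟩ := ENat.ne_top_iff_exists.mp ha'
    exact ⟨d', ha.symm⟩
  obtain ⟨e, he⟩ : ∃ e : ℕ, ringKrullDim (B ⧸ underPrime I 𝔓) = e := by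
    haveI : IsDomain (B ⧸ underPrime I 𝔓) := Ideal.Quotient.isDomain _
    obtain ⟨e, he, -⟩ :=
      Literature.RingTheory.KrullDimension.exists_ringKrullDim_eq_and_trdeg_eq k
        (B ⧸ underPrime I 𝔓)
    exact ⟨e, he⟩
  have hsum := height_add_eq_of_ringKrullDim_quotient k hB (underPrime I 𝔓) he hn'
  have hineq := supportDim_quotientLocalization_add_le I 𝔓
  rw [hd', he, Module.supportDim_quotient_eq_ringKrullDim, hd] at hineq
  have hineq' : d' + e ≤ d := by
    have : ((d' + e : ℕ) : WithBot ℕ∞) ≤ d := by exact_mod_cast hineq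
    exact_mod_cast this
  exact ⟨n', d', hdimBp, hd', Ioc_subset_Ioc_of_add_eq_of_add_le hsum hineq'⟩

variable [IsRegularRing B] (I : Ideal B) [I.IsPrime]

include k hB in
/-- **`𝔠 ⊄ I`**: the global `Ext`-annihilator ideal of `A = B/I` is not contained in `I`
(so `J = 𝔠A ≠ 0`), by `(A1)` at the prime `I` of height `n - dim A`.
[cite: Kawasaki2000, La. 2.4 (1); BrunsHerzog1998, Thm. 8.1.1] -/
theorem prod_annihilator_EMod_not_le_of_quotient (F : FreeResolution B (B ⧸ I)) {d : ℕ}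
    (hd : ringKrullDim (B ⧸ I) = d) :
    ¬ (∏ q ∈ Finset.Ioc (n - d) (max n 2), Module.annihilator B (F.EMod q)) ≤ I := by
  -- `(A1)` of `ExtAnnihilatorSupport.lean` over the regular DOMAIN `B` at the prime `I` of height
  -- `h = n - d`: `B_I` is regular local of dimension `h`, so `pd_{B_I} A_I ≤ h ≤ q - 1` for every
  -- `q` in the window, and `Ann E^q ⊄ I` (`FreeResolution.annihilator_EMod_not_le`).
  obtain ⟨h, hh⟩ := exists_height_eq k I
  have hsum := height_add_eq_of_ringKrullDim_quotient k hB I hd hh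
  haveI : IsNoetherianRing B := Algebra.FiniteType.isNoetherianRing k B
  intro hle
  obtain ⟨q, hq, hq'⟩ := (Ideal.IsPrime.prod_le inferInstance).mp hle
  rw [Finset.mem_Ioc] at hq
  obtain ⟨q', rfl⟩ : ∃ q', q = q' + 1 := ⟨q - 1, by omega⟩
  refine F.annihilator_EMod_not_le I q' ?_ hq'
  haveI : IsRegularLocalRing (Localization.AtPrime I) :=
    IsRegularRing.isRegularLocalRing_localization I
  obtain ⟨xs, hxreg, hxspan, hxlen⟩ :=
    exists_isRegular_ofList_eq_maximalIdeal (R := Localization.AtPrime I)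
  have hpd := hasProjectiveDimensionLE_length_of_isWeaklyRegular hxreg.toIsWeaklyRegular hxspan
    (ModuleCat.of (Localization.AtPrime I) (LocalizedModule I.primeCompl (B ⧸ I)))
  rw [IsLocalization.AtPrime.ringKrullDim_eq_height I (Localization.AtPrime I), hh] at hxlen
  have hlen : xs.length = h := by exact_mod_cast hxlen
  haveI := hpd
  haveI : CategoryTheory.HasProjectiveDimensionLE
      (ModuleCat.of (Localization.AtPrime I) (LocalizedModule I.primeCompl (B ⧸ I))) q' :=
    CategoryTheory.hasProjectiveDimensionLT_of_ge _ (xs.length + 1) (q' + 1) (by omega)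
  exact (F.localize I).projective_syzygyObj_of_hasProjectiveDimensionLE this q' le_rfl

include k hB in
/-- **`J = 𝔠A ≠ ⊥`** in the domain `A = B/I`. [cite: Kawasaki2000, La. 2.4 (1)] -/
theorem map_prod_annihilator_EMod_ne_bot (F : FreeResolution B (B ⧸ I)) {d : ℕ}
    (hd : ringKrullDim (B ⧸ I) = d) :
    (∏ q ∈ Finset.Ioc (n - d) (max n 2), Module.annihilator B (F.EMod q)).map
      (Ideal.Quotient.mk I) ≠ ⊥ := by
  intro h
  apply prod_annihilator_EMod_not_le_of_quotient k hB I F hd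
  intro z hz
  rw [← Ideal.Quotient.eq_zero_iff_mem, ← Ideal.mem_bot, ← h]
  exact Ideal.mem_map_of_mem _ hz

omit [I.IsPrime] in
include k hB in
/-- **Off `V(J)` the local rings are Cohen–Macaulay.** For a prime `𝔓` of `A = B/I` not containing
`J = 𝔠A`, every system of parameters of `A_𝔓` is a weakly regular sequence.
[cite: Kawasaki2000, La. 2.4 (2), proof of Thm. 5.1; Cesnavicius2021, §2 (AR-b)] -/
theorem cmClause_localization_of_not_le (F : FreeResolution B (B ⧸ I)) {d : ℕ}
    (hd : ringKrullDim (B ⧸ I) = d) (𝔓 : Ideal (B ⧸ I)) [𝔓.IsPrime]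
    (hJ : ¬ (∏ q ∈ Finset.Ioc (n - d) (max n 2), Module.annihilator B (F.EMod q)).map
      (Ideal.Quotient.mk I) ≤ 𝔓) :
    ∀ d' : ℕ, ringKrullDim (Localization.AtPrime 𝔓) = d' → ∀ s : Fin d' → Localization.AtPrime 𝔓,
      (Ideal.span (Set.range s)).radical.IsMaximal →
        RingTheory.Sequence.IsWeaklyRegular (Localization.AtPrime 𝔓) (List.ofFn s) := by
  letI := quotientLocalizationAlgebra I 𝔓
  obtain ⟨𝔠, h𝔠⟩ : ∃ 𝔠 : Ideal B,
      (∏ q ∈ Finset.Ioc (n - d) (max n 2), Module.annihilator B (F.EMod q)) = 𝔠 := ⟨_, rfl⟩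
  rw [h𝔠] at hJ
  have h𝔠𝔭 : ¬ 𝔠 ≤ underPrime I 𝔓 := fun hle => hJ (by
    rw [Ideal.map_le_iff_le_comap]; exact hle)
  haveI : IsRegularLocalRing (Localization.AtPrime (underPrime I 𝔓)) :=
    IsRegularRing.isRegularLocalRing_localization _
  obtain ⟨n', d', hn', hd', hwindow⟩ := exists_window k hB I 𝔓 hd
  -- `𝔠 B_𝔭 = B_𝔭`, hence the local `Ext`-annihilator ideal of `F ⊗ B_𝔭` is the unit ideal
  have hmaptop : 𝔠.map (algebraMap B (Localization.AtPrime (underPrime I 𝔓))) = ⊤ := by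
    obtain ⟨z, hz, hz𝔭⟩ := SetLike.not_le_iff_exists.mp h𝔠𝔭
    exact Ideal.eq_top_of_isUnit_mem _ (Ideal.mem_map_of_mem _ hz)
      (IsLocalization.map_units _ (⟨z, hz𝔭⟩ : (underPrime I 𝔓).primeCompl))
  have h3 := map_prod_annihilator_EMod_le_quotientLocalize I 𝔓 F
    (Finset.Ioc (n' - d') (max n' 2)) (fun q hq => one_le_of_mem_Ioc hq)
  have h2 : 𝔠.map (algebraMap B (Localization.AtPrime (underPrime I 𝔓))) ≤
      (∏ q ∈ Finset.Ioc (n' - d') (max n' 2), Module.annihilator B (F.EMod q)).map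
        (algebraMap B (Localization.AtPrime (underPrime I 𝔓))) :=
    Ideal.map_mono (by rw [← h𝔠]; exact F.prod_annihilator_EMod_anti hwindow)
  have htop := top_le_iff.mp (hmaptop.symm.le.trans (h2.trans h3))
  exact cmClause_of_prod_annihilator_EMod_eq_top (algebraMap_quotientLocalization_surjective I 𝔓)
    (F.quotientLocalize I 𝔓) hn' hd' htop

end Affine

end Literature.AlgebraicGeometry.Resolution

end
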